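import Literature.NumberTheory.Transcendental.CurvePeriodsContinuousTrianglesProofs
import Mathlib.Topology.Homotopy.Path
import HarnessLib

/-!
# Periods of curve type: the symbol of a path only depends on its homotopy class

Companion of `Literature/NumberTheory/Transcendental/CurvePeriods.lean` (Huber–Wüstholz 2022,
Thm. 13.3 (2), rendered on explicit period symbols `(Z, ω, γ)` with the elementary relations
(R1)–(R5); the general statement is the named fact `HuberWustholzCurvePeriods`). This file
bridges the `C¹` paths `CurvePath Z` of the rendering to Mathlib's continuous paths
`Path x y` in the topological subspace `Z(ℂ) ⊂ ℂⁿ` and their homotopy classes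
(`Path.Homotopic`), so that the groupoid calculus of Mathlib (`Path.trans`, `Path.symm`,
`Path.Homotopy.transAssoc`, …) becomes available for symbols:

* `CurvePath.toPath` — a `C¹` path as a `Path` in `↥Z.points`;
* `span_single_sub_single_of_homotopic` — **the symbol only depends on the homotopy class with
  fixed end points**: if `C¹` paths `γ₀`, `γ₁` agree pointwise with paths `p₀ p₁ : Path x y` in
  `Z(ℂ)` and `p₀.Homotopic p₁`, then `(Z, ω, γ₀) ∼ (Z, ω, γ₁)` (from the continuous-homotopy
  theorem `span_single_sub_single_of_continuousHomotopy`);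
* `exists_path_concat` — the `C¹` concatenation `γ₁ ⋆ γ₂` (`CurvePath.concat`, smooth-step
  parametrisation) is a reparametrisation of, hence homotopic to, `Path.trans`;
  `CurvePath.reverse_eq_symm`, `CurvePath.const_eq_refl`;
* consequences: `span_single_of_nullhomotopic` (null-homotopic `C¹` loops have symbol `∼ 0`),
  `span_of_homotopic_trans` (`p ≃ p₁ ⋆ p₂ ⇒ (γ) ∼ (γ₁) + (γ₂)`),
  `span_single_sub_single_of_conjugate` (loops conjugate by a `C¹` path have the same symbol:
  `p₀ ≃ d ⋆ p₁ ⋆ d⁻¹ ⇒ (γ₀) ∼ (γ₁)`).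

These are the statements of §3.3.1 of the book ("`H₁^sing` is computed by smooth paths; up to
homotopy …") in the strongest form available without a singular homology library.

## References

* A. Huber, G. Wüstholz, *Transcendence and Linear Relations of 1-Periods*, Cambridge Tracts in
  Mathematics 227, CUP 2022 [HuberWustholz2022]: §3.3.1 (pp. 42–44 of the held text), Thm. 13.3 (2)
  (p. 121).
-/

noncomputable section

open scoped BigOperators Topology unitInterval
open MvPolynomial Set Filter

namespace Literature.NumberTheory.Transcendental

namespace CurvePeriods

set_option quotPrecheck false in
/-- Membership in the `ℚ̄`-span of the elementary relations, in the format of the conclusion of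
`HuberWustholzCurvePeriods`. -/
local notation "InSpan" c:max => ∃ (k : ℕ) (ρ : Fin k → (PeriodSymbol →₀ ℂ)) (a : Fin k → ℂ),
  (∀ l, IsElementaryRelation (ρ l)) ∧ (∀ l, IsAlgebraic ℚ (a l)) ∧ c = ∑ l, a l • ρ l

variable {Z : CurveData}

/-! ### `C¹` paths as paths in the subspace `Z(ℂ)` -/

/-- The initial point of a `C¹` path, as a point of the subspace `Z(ℂ)`. [folklore] -/
def CurvePath.src (γ : CurvePath Z) : Z.points := ⟨γ.toFun 0, γ.mem_points 0 ⟨le_rfl, zero_le_one⟩⟩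

/-- The end point of a `C¹` path, as a point of the subspace `Z(ℂ)`. [folklore] -/
def CurvePath.tgt (γ : CurvePath Z) : Z.points := ⟨γ.toFun 1, γ.mem_points 1 ⟨zero_le_one, le_rfl⟩⟩

/-- A `C¹` path on `Z` as a continuous path in the topological subspace `Z(ℂ) ⊂ ℂⁿ`.
[folklore] -/
def CurvePath.toPath (γ : CurvePath Z) : Path γ.src γ.tgt where
  toFun t := ⟨γ.toFun t, γ.mem_points t t.2⟩
  continuous_toFun := (γ.contDiffOn.continuousOn.comp_continuous continuous_subtype_val
    (fun t => t.2)).subtype_mk _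
  source' := rfl
  target' := rfl

/-- `γ.toPath` is `γ` pointwise. [folklore] -/
@[simp] theorem CurvePath.toPath_apply (γ : CurvePath Z) (t : I) :
    ((γ.toPath t : Z.points) : Fin Z.n → ℂ) = γ.toFun t := rfl

/-- `γ` agrees with `γ.toPath` on `[0,1]` (the format of the hypotheses below). [folklore] -/
theorem CurvePath.toFun_eq_toPath (γ : CurvePath Z) : ∀ t : I, γ.toFun t = γ.toPath t :=
  fun _ => rfl

/-- A `C¹` path agreeing with `p : Path x y` starts at `x`. [folklore] -/
theorem toFun_zero_of_eq_path {x y : Z.points} {p : Path x y} {γ : CurvePath Z}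
    (hγ : ∀ t : I, γ.toFun t = p t) : γ.toFun 0 = x := by
  have h0 := hγ 0
  rwa [Set.Icc.coe_zero, p.source] at h0

/-- A `C¹` path agreeing with `p : Path x y` ends at `y`. [folklore] -/
theorem toFun_one_of_eq_path {x y : Z.points} {p : Path x y} {γ : CurvePath Z}
    (hγ : ∀ t : I, γ.toFun t = p t) : γ.toFun 1 = y := by
  have h1 := hγ 1
  rwa [Set.Icc.coe_one, p.target] at h1

/-! ### Homotopic paths have the same symbol -/

/-- **The symbol only depends on the homotopy class of the path (fixed end points).** Let
`p₀ p₁ : Path x y` be continuous paths in `Z(ℂ)` which are homotopic with fixed end points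
(`Path.Homotopic`, i.e. in the topological space `Z(ℂ)`), and let `γ₀`, `γ₁` be `C¹` paths with
algebraic end points agreeing with them on `[0,1]`. Then `(Z, ω, γ₀) − (Z, ω, γ₁)` lies in the
span of the elementary relations (the homotopy, extended to `ℝ²` by projection onto the square,
is a continuous homotopy as in `span_single_sub_single_of_continuousHomotopy`).
[cite: HuberWustholz2022, §3.3.1 (pp. 42–44)] -/
theorem span_single_sub_single_of_homotopic (hZ : Z.IsSmoothAffineCurve)
    (ω : Fin Z.n → MvPolynomial (Fin Z.n) ℂ) (h : ∀ i, HasAlgCoeffs (ω i)) {x y : Z.points}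
    (p₀ p₁ : Path x y) (hp : p₀.Homotopic p₁) (γ₀ γ₁ : CurvePath Z)
    (hγ₀ : ∀ t : I, γ₀.toFun t = p₀ t) (hγ₁ : ∀ t : I, γ₁.toFun t = p₁ t) :
    InSpan (Finsupp.single (⟨Z, hZ, ω, h, γ₀⟩ : PeriodSymbol) (1 : ℂ) -
        Finsupp.single ⟨Z, hZ, ω, h, γ₁⟩ 1) := by
  obtain ⟨F⟩ := hp
  let π : ℝ → I := projIcc (0 : ℝ) 1 zero_le_one
  have hπ : Continuous π := continuous_projIcc
  have hπmem : ∀ {t : ℝ} (ht : t ∈ Icc (0 : ℝ) 1), π t = ⟨t, ht⟩ := fun ht => projIcc_of_mem _ ht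
  have hπ0 : π 0 = 0 := (hπmem ⟨le_rfl, zero_le_one⟩).trans (Set.Icc.mk_zero _)
  have hπ1 : π 1 = 1 := (hπmem ⟨zero_le_one, le_rfl⟩).trans (Set.Icc.mk_one _)
  let H : ℝ × ℝ → (Fin Z.n → ℂ) := fun q => ((F (π q.1, π q.2) : Z.points) : Fin Z.n → ℂ)
  have hHc : Continuous H :=
    continuous_subtype_val.comp
      (F.continuous.comp ((hπ.comp continuous_fst).prodMk (hπ.comp continuous_snd)))
  refine span_single_sub_single_of_continuousHomotopy hZ ω h H hHc.continuousOn
    (fun q _ => (F (π q.1, π q.2)).2) (fun s _ => ?_) (fun s _ => ?_) γ₀ γ₁ (fun t ht => ?_)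
    (fun t ht => ?_)
  · show ((F (π s, π 0) : Z.points) : Fin Z.n → ℂ) = F (π 0, π 0)
    rw [hπ0, F.source, F.source]
  · show ((F (π s, π 1) : Z.points) : Fin Z.n → ℂ) = F (π 0, π 1)
    rw [hπ1, F.target, F.target]
  · show γ₀.toFun t = F (π 0, π t)
    rw [hπ0, hπmem ht, F.apply_zero]
    exact hγ₀ ⟨t, ht⟩
  · show γ₁.toFun t = F (π 1, π t)
    rw [hπ1, hπmem ht, F.apply_one]
    exact hγ₁ ⟨t, ht⟩

/-- The version with `γᵢ.toPath`: if `γ₁.toPath`, transported to the end points of `γ₀`, is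
homotopic to `γ₀.toPath`, the symbols agree. [cite: HuberWustholz2022, §3.3.1 (pp. 42–44)] -/
theorem span_single_sub_single_of_homotopic_toPath (hZ : Z.IsSmoothAffineCurve)
    (ω : Fin Z.n → MvPolynomial (Fin Z.n) ℂ) (h : ∀ i, HasAlgCoeffs (ω i)) (γ₀ γ₁ : CurvePath Z)
    (h0 : γ₀.toFun 0 = γ₁.toFun 0) (h1 : γ₀.toFun 1 = γ₁.toFun 1)
    (hp : γ₀.toPath.Homotopic (γ₁.toPath.cast (Subtype.ext h0) (Subtype.ext h1))) :
    InSpan (Finsupp.single (⟨Z, hZ, ω, h, γ₀⟩ : PeriodSymbol) (1 : ℂ) -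
        Finsupp.single ⟨Z, hZ, ω, h, γ₁⟩ 1) :=
  span_single_sub_single_of_homotopic hZ ω h _ _ hp γ₀ γ₁ (fun _ => rfl) (fun _ => rfl)

/-! ### Concatenation, reversal, constants versus `Path.trans`, `Path.symm`, `Path.refl` -/

/-- `φ(x) = x²(3 − 2x) > 0` for `0 < x ≤ 1`. [folklore] -/
theorem smoothStep_pos {x : ℝ} (h0 : 0 < x) (h1 : x ≤ 1) : 0 < smoothStep x := by
  unfold smoothStep
  exact mul_pos (mul_pos h0 h0) (by linarith)

/-- The change of parameter `θ` with `γ₁ ⋆ γ₂ = (γ₁.trans γ₂) ∘ θ`: `φ(2t)/2` on `[0, 1/2]`,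
`(1 + φ(2t − 1))/2` on `[1/2, 1]`. [folklore] -/
def concatReparamFun (t : ℝ) : ℝ :=
  if t ≤ 1 / 2 then smoothStep (2 * t) / 2 else (1 + smoothStep (2 * t - 1)) / 2

/-- `θ` is continuous. [folklore] -/
theorem continuous_concatReparamFun : Continuous concatReparamFun := by
  refine Continuous.if_le (continuous_smoothStep_two_mul.div_const _)
    ((continuous_const.add continuous_smoothStep_two_mul_sub_one).div_const _) continuous_id
    continuous_const (fun t ht => ?_)
  rw [ht]
  norm_num

/-- `θ([0,1]) ⊆ [0,1]`. [folklore] -/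
theorem concatReparamFun_mem {t : ℝ} (ht : t ∈ Icc (0 : ℝ) 1) :
    concatReparamFun t ∈ Icc (0 : ℝ) 1 := by
  unfold concatReparamFun
  split_ifs with hle
  · have hu := mapsTo_smoothStep (two_mul_mem_Icc ⟨ht.1, hle⟩)
    exact ⟨by linarith [hu.1], by linarith [hu.2]⟩
  · have hu := mapsTo_smoothStep (two_mul_sub_one_mem_Icc ⟨(not_le.mp hle).le, ht.2⟩)
    exact ⟨by linarith [hu.1], by linarith [hu.2]⟩

/-- `θ` as a self-map of the unit interval. [folklore] -/
def concatReparam (t : I) : I := ⟨concatReparamFun t, concatReparamFun_mem t.2⟩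

/-- `θ` is continuous. [folklore] -/
theorem continuous_concatReparam : Continuous concatReparam :=
  (continuous_concatReparamFun.comp continuous_subtype_val).subtype_mk _

/-- `θ(0) = 0`. [folklore] -/
theorem concatReparam_zero : concatReparam 0 = 0 :=
  Subtype.ext (by norm_num [concatReparam, concatReparamFun])

/-- `θ(1) = 1`. [folklore] -/
theorem concatReparam_one : concatReparam 1 = 1 :=
  Subtype.ext (by norm_num [concatReparam, concatReparamFun])

/-- **`C¹` concatenation versus `Path.trans`.** If `γ₁`, `γ₂` agree with `p₁ : Path x y`,
`p₂ : Path y z`, then `γ₁ ⋆ γ₂` (`CurvePath.concat`) agrees with the reparametrisation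
`(p₁.trans p₂) ∘ θ`, which is homotopic to `p₁.trans p₂`. [folklore] -/
theorem exists_path_concat {x y z : Z.points} (p₁ : Path x y) (p₂ : Path y z)
    (γ₁ γ₂ : CurvePath Z) (hj : γ₁.toFun 1 = γ₂.toFun 0) (h₁ : ∀ t : I, γ₁.toFun t = p₁ t)
    (h₂ : ∀ t : I, γ₂.toFun t = p₂ t) :
    ∃ p : Path x z, (∀ t : I, (γ₁.concat γ₂ hj).toFun t = p t) ∧ p.Homotopic (p₁.trans p₂) := by
  refine ⟨(p₁.trans p₂).reparam concatReparam continuous_concatReparam concatReparam_zero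
      concatReparam_one, fun t => ?_,
    ⟨(Path.Homotopy.reparam (p₁.trans p₂) concatReparam continuous_concatReparam
      concatReparam_zero concatReparam_one).symm⟩⟩
  rw [Path.coe_reparam, Function.comp_apply, Path.trans_apply, CurvePath.concat_apply]
  by_cases hle : (t : ℝ) ≤ 1 / 2
  · have hθ : ((concatReparam t : I) : ℝ) = smoothStep (2 * t) / 2 := if_pos hle
    have hu := mapsTo_smoothStep (two_mul_mem_Icc ⟨t.2.1, hle⟩)
    have hθle : ((concatReparam t : I) : ℝ) ≤ 1 / 2 := by rw [hθ]; linarith [hu.2]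
    rw [if_pos hle, dif_pos hθle, ← h₁]
    congr 1
    push_cast
    rw [hθ]
    ring
  · have hu := two_mul_sub_one_mem_Icc ⟨(not_le.mp hle).le, t.2.2⟩
    have hpos : 0 < smoothStep (2 * t - 1) := smoothStep_pos (by linarith [not_le.mp hle]) hu.2
    have hθ : ((concatReparam t : I) : ℝ) = (1 + smoothStep (2 * t - 1)) / 2 := if_neg hle
    have hθgt : ¬ ((concatReparam t : I) : ℝ) ≤ 1 / 2 := by rw [hθ]; intro h'; linarith
    rw [if_neg hle, dif_neg hθgt, ← h₂]
    congr 1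
    push_cast
    rw [hθ]
    ring

/-- **Reversal versus `Path.symm`**: if `γ` agrees with `p`, then `γ.reverse` agrees with
`p.symm`. [folklore] -/
theorem CurvePath.reverse_eq_symm {x y : Z.points} (p : Path x y) (γ : CurvePath Z)
    (hγ : ∀ t : I, γ.toFun t = p t) : ∀ t : I, γ.reverse.toFun t = p.symm t := fun t => by
  show γ.toFun (1 - t) = p (σ t)
  rw [← hγ (σ t), unitInterval.coe_symm_eq]

/-- **Constants versus `Path.refl`**: the constant path at an algebraic point `P` agrees with
`Path.refl ⟨P, _⟩`. [folklore] -/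
theorem CurvePath.const_eq_refl (P : Fin Z.n → ℂ) (hP : P ∈ Z.points)
    (ha : ∀ i, IsAlgebraic ℚ (P i)) :
    ∀ t : I, (CurvePath.const P hP ha).toFun t = (Path.refl (⟨P, hP⟩ : Z.points)) t :=
  fun _ => rfl

/-! ### Consequences -/

/-- **Null-homotopic loops have symbol `∼ 0`.** If the `C¹` loop `γ` agrees with a loop
`p : Path x x` in `Z(ℂ)` which is homotopic (with fixed base point) to the constant loop, then
`(Z, ω, γ)` lies in the span of the elementary relations.
[cite: HuberWustholz2022, §3.3.1 (pp. 42–44)] -/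
theorem span_single_of_nullhomotopic (hZ : Z.IsSmoothAffineCurve)
    (ω : Fin Z.n → MvPolynomial (Fin Z.n) ℂ) (h : ∀ i, HasAlgCoeffs (ω i)) {x : Z.points}
    (p : Path x x) (hp : p.Homotopic (Path.refl x)) (γ : CurvePath Z)
    (hγ : ∀ t : I, γ.toFun t = p t) :
    InSpan (Finsupp.single (⟨Z, hZ, ω, h, γ⟩ : PeriodSymbol) (1 : ℂ)) := by
  have hx : (x : Fin Z.n → ℂ) = γ.toFun 0 := (toFun_zero_of_eq_path hγ).symm
  have ha : ∀ i, IsAlgebraic ℚ ((x : Fin Z.n → ℂ) i) := fun i => hx ▸ γ.algebraic_zero i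
  have h1 := span_single_sub_single_of_homotopic hZ ω h p (Path.refl x) hp γ
    (CurvePath.const x x.2 ha) hγ (fun _ => rfl)
  have h2 := span_of_rel (isElementaryRelation_single_of_const hZ ω h
    (CurvePath.const (x : Fin Z.n → ℂ) x.2 ha) x (fun _ _ => rfl))
  have h3 := span_add h1 h2
  rwa [sub_add_cancel] at h3

/-- **Additivity along `Path.trans` up to homotopy.** If `γ`, `γ₁`, `γ₂` agree with `p`, `p₁`,
`p₂` and `p ≃ p₁.trans p₂` with fixed end points, then `(Z, ω, γ) − (Z, ω, γ₁) − (Z, ω, γ₂)`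
lies in the span of the elementary relations. [cite: HuberWustholz2022, §3.3.1 (pp. 42–44)] -/
theorem span_of_homotopic_trans (hZ : Z.IsSmoothAffineCurve)
    (ω : Fin Z.n → MvPolynomial (Fin Z.n) ℂ) (h : ∀ i, HasAlgCoeffs (ω i)) {x y z : Z.points}
    (p : Path x z) (p₁ : Path x y) (p₂ : Path y z) (hp : p.Homotopic (p₁.trans p₂))
    (γ γ₁ γ₂ : CurvePath Z) (hγ : ∀ t : I, γ.toFun t = p t) (h₁ : ∀ t : I, γ₁.toFun t = p₁ t)
    (h₂ : ∀ t : I, γ₂.toFun t = p₂ t) :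
    InSpan (Finsupp.single (⟨Z, hZ, ω, h, γ⟩ : PeriodSymbol) (1 : ℂ) -
        Finsupp.single ⟨Z, hZ, ω, h, γ₁⟩ 1 - Finsupp.single ⟨Z, hZ, ω, h, γ₂⟩ 1) := by
  have hj : γ₁.toFun 1 = γ₂.toFun 0 := by
    rw [toFun_one_of_eq_path h₁, toFun_zero_of_eq_path h₂]
  obtain ⟨q, hq, hqh⟩ := exists_path_concat p₁ p₂ γ₁ γ₂ hj h₁ h₂
  have hhom := span_single_sub_single_of_homotopic hZ ω h p q (hp.trans hqh.symm) γ
    (γ₁.concat γ₂ hj) hγ hq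
  have hcat := span_concat hZ ω h γ₁ γ₂ hj
  obtain ⟨k, ρ, a, hρ, ha, he⟩ := span_add hhom hcat
  exact ⟨k, ρ, a, hρ, ha, by rw [← he]; abel⟩

/-- **Conjugate loops have the same symbol.** Let `γ₀` be a `C¹` loop at `x`, `γ₁` a `C¹` loop
at `y` and `δ` a `C¹` path from `x` to `y` (all with algebraic end points), agreeing with
`p₀ : Path x x`, `p₁ : Path y y`, `d : Path x y`. If `p₀ ≃ d ⋆ (p₁ ⋆ d⁻¹)` with fixed base
point — equivalently, the free homotopy classes of the loops agree, the base point moving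
along `d` — then `(Z, ω, γ₀) − (Z, ω, γ₁)` lies in the span of the elementary relations
(`span_single_sub_single_of_homotopic` and `span_conj`).
[cite: HuberWustholz2022, §3.3.1 (pp. 42–44): "a closed path"] -/
theorem span_single_sub_single_of_conjugate (hZ : Z.IsSmoothAffineCurve)
    (ω : Fin Z.n → MvPolynomial (Fin Z.n) ℂ) (h : ∀ i, HasAlgCoeffs (ω i)) {x y : Z.points}
    (p₀ : Path x x) (p₁ : Path y y) (d : Path x y) (hp : p₀.Homotopic (d.trans (p₁.trans d.symm)))
    (γ₀ γ₁ δ : CurvePath Z) (hγ₀ : ∀ t : I, γ₀.toFun t = p₀ t) (hγ₁ : ∀ t : I, γ₁.toFun t = p₁ t)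
    (hδ : ∀ t : I, δ.toFun t = d t) :
    InSpan (Finsupp.single (⟨Z, hZ, ω, h, γ₀⟩ : PeriodSymbol) (1 : ℂ) -
        Finsupp.single ⟨Z, hZ, ω, h, γ₁⟩ 1) := by
  have hℓ₀ : γ₁.toFun 0 = δ.toFun 1 := by
    rw [toFun_zero_of_eq_path hγ₁, toFun_one_of_eq_path hδ]
  have hℓ₁ : γ₁.toFun 1 = δ.toFun 1 := by
    rw [toFun_one_of_eq_path hγ₁, toFun_one_of_eq_path hδ]
  have hj₁ : γ₁.toFun 1 = δ.reverse.toFun 0 := by rw [hℓ₁]; simp [CurvePath.reverse]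
  obtain ⟨q₁, hq₁, hq₁h⟩ := exists_path_concat p₁ d.symm γ₁ δ.reverse hj₁ hγ₁
    (CurvePath.reverse_eq_symm d δ hδ)
  have hj₀ : δ.toFun 1 = (γ₁.concat δ.reverse hj₁).toFun 0 := by
    rw [CurvePath.concat_zero, hℓ₀]
  obtain ⟨q, hq, hqh⟩ := exists_path_concat d q₁ δ (γ₁.concat δ.reverse hj₁) hj₀ hδ hq₁
  have hhom := span_single_sub_single_of_homotopic hZ ω h p₀ q
    (hp.trans ((Path.Homotopic.refl d).hcomp hq₁h.symm |>.trans hqh.symm)) γ₀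
    (δ.concat (γ₁.concat δ.reverse hj₁) hj₀) hγ₀ hq
  have hconj := span_conj hZ ω h δ γ₁ hℓ₀ hℓ₁
  obtain ⟨k, ρ, a, hρ, ha, he⟩ := span_add hhom hconj
  exact ⟨k, ρ, a, hρ, ha, by rw [← he]; abel⟩

end CurvePeriods

end Literature.NumberTheory.Transcendental

end
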